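import Mathlib
import Literature.MathematicalPhysics.QuantumFieldTheory.BalabanImbrieJaffe1984to88.BIJ85Eq7111EdgeAverage

/-!
# `BalabanImbrieJaffe1984to88.BIJ85Eq7111EdgeAdjoint` — T. Bałaban, J. Imbrie, A. Jaffe, *Renormalization of the Higgs
model: minimizers, propagators and the stability of mean field theory*, Commun. Math. Phys. **97** (1985) 299–329
[BalabanImbrieJaffe1985]: Sect. 2 p. 305 — **the adjoint `Q^{e*}_k` of the k-fold edge average, (2.22) composed k times, and
(2.24) `Q^e_kQ^{e*}_k = L^{2k}I = η^{−2}I` for the CONCRETE configuration-space operator** of `BIJ85Eq7111EdgeAverage`, PROVED; and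
(2.24) IN MOMENTUM SPACE: `Σ_l |w_{μν}(p′+l)|² = η^{−2}` for the (7.1.11) weight — file 13 of the (7.1.2) cluster

statement-level skeleton of published theorems with citation tags; proofs where landed; nothing here is a claim about
the Yang–Mills mass gap

PDF held: `paper:balaban1985-cmp97-bij-higgs-minimizers` (journal page = PDF page + 298).  Text read as image: PDF p. 7 (journal
305; `run/shared/lean/pub/lit-balaban/lit-balaban-r15/pages/1985-cmp97-bij-higgs-minimizers-p007-x2.png`).

CITATION HEADER (lean-in-tree rule).  Part of the lit-balaban TYPED SKELETON (HOME `run/shared/lean/pub/lit-balaban/`); WHAT IS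
REPRODUCED: rows **C1.Eq2.20-2.23** / **C1.Eq2.24** (p. 305 [PDF 7], verbatim: *"The natural scalar product for functions on lattice
plaquettes is ⟨f, g⟩_a = Σ_p a^d f_p g_p, (2.20) where p is a plaquette on the a-lattice. … Then (Q^{e*}f)(p) = L²f(p′) if
p ∈ B^e(p′), 0 otherwise. (2.22) Also Q^eQ^{e*} = L²I, Q^{e*}Q^e = L²P^e, (2.23) … Especially important are Q^e_k ≡ (Q^e)^k and
Q^s_k = (Q^s)^k which satisfy Q^e_kQ^{e*}_k = L^{2k}I = η^{−2}I, Q^s_kQ^{s*}_k = L^kI = η^{−1}I, (2.24) where η = L^{−k}"*) for the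
EDGE operators, in the configuration-space model of `BIJ85Eq7111EdgeAverage` (`edgeAvgC` = (2.21)^k on η-plaquette fields over
`Tor (fine n M)`; the abstract one-step versions are seat p19's `BIJ85Eq224Proof` and `BIJ85CellAverages`), `HOME/lit-balaban-r15/ROWS-C1.md`
(owner r15, referee ref-5).  TYPED READING: the adjoint is taken between `⟨·,·⟩_η = η^dΣ` on η-plaquette fields and `⟨·,·⟩_1 = Σ`
on unit plaquette fields (2.20), so as a matrix `Q^{e*}_k = η^{−d}·(Q^e_k)ᴴ = n^d·(edgeAvgC)ᴴ` (`edgeAdjC`, `inner_edgeAvgC`); `η^{−2} = n²`;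
the orientation components `(μ,μ)` carry no two-form and (2.24) is stated on the orientations `μ ≠ ν` (hence `2 ≤ d`).
WHAT IS KERNEL-CHECKED (zero `sorry`, standard axioms): `edgeAvgC_apply_bpt` (the kernel of `Q^e_k` on block coordinates, by the
block partition `B5Blocks16.bpt_injective`), `card_edgeOffsets` (`|B^e_k(y;μν)| = n^{d−2}`), **`inner_edgeAvgC`** (`⟨g, Q^e_kf⟩_1 =
⟨Q^{e*}_kg, f⟩_η`), **(2.22)_k `edgeAdjC_mulVec`** (`(Q^{e*}_kg)_{μν}(x) = η^{−2}g_{μν}(y)` if `x ∈ B^e_k(y;μν)`, `0` otherwise), **(2.24)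
`edgeAvgC_edgeAdjC_mulVec`** (`Q^e_kQ^{e*}_kg = η^{−2}g` on every orientation `μ ≠ ν`) with the entrywise form `edgeAvgC_mul_edgeAdjC_apply`,
and **(2.24) in momentum space `sum_normSq_edgeW`**: `Σ_l |w_{μν}(p′+l)|² = n² = η^{−2}` for the weight of (7.1.11) (via the symbol rules of
`BIJ85Eq7111CrossSymbols`: `σ_{Q^e_kQ^{e*}_k}(p′) = Σ_l w w̄`).  NOT CLAIMED: `Q^{e*}_kQ^e_k = η^{−2}P^e_k` ((2.23)_k), the surface
operators Q^s_k.  Unit `lit-balaban-p27` (gen 5), HOME as above.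
-/

namespace Literature.MathematicalPhysics.QuantumFieldTheory.BalabanImbrieJaffe1984to88.BIJ85Eq7111EdgeAdjoint

open scoped BigOperators Matrix ComplexConjugate
open Finset Complex
open Literature.MathematicalPhysics.QuantumFieldTheory.Balaban1983to89
open Literature.MathematicalPhysics.QuantumFieldTheory.Balaban1983to89.B5Prop11Plancherel
open Literature.MathematicalPhysics.QuantumFieldTheory.Balaban1983to89.B5Prop11Fiber
open Literature.MathematicalPhysics.QuantumFieldTheory.Balaban1983to89.B5Block118
open Literature.MathematicalPhysics.QuantumFieldTheory.Balaban1983to89.B5Blocks16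
open Literature.MathematicalPhysics.QuantumFieldTheory.BalabanImbrieJaffe1984to88.BIJ85Eq712Plancherel
open Literature.MathematicalPhysics.QuantumFieldTheory.BalabanImbrieJaffe1984to88.BIJ85Eq712SymbolCalculus
open Literature.MathematicalPhysics.QuantumFieldTheory.BalabanImbrieJaffe1984to88.BIJ85Eq7111CrossSymbols
open Literature.MathematicalPhysics.QuantumFieldTheory.BalabanImbrieJaffe1984to88.BIJ85Eq7111EdgeAverage

noncomputable section

variable {d : ℕ} (n : ℕ) [NeZero n] (M : Fin d → ℕ) [hM : ∀ μ, NeZero (M μ)]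

/-! ## §1 The kernel of `Q^e_k` on block coordinates; `|B^e_k(y;μν)| = n^{d−2}` -/

/-- The kernel of `Q^e_k` between the unit plaquette `(y′, μ′ν′)` and the η-plaquette at `n·y + j` with orientation `a`:
`η^{d−2}` iff the orientations agree, `y = y′` and `j ∈ B^e_k(μ′ν′)`; else `0` (the blocks partition `T_η`,
`B5Blocks16.bpt_injective`). [cite: BalabanImbrieJaffe1985, (2.21) p.305] -/
theorem edgeAvgC_apply_bpt (y' : Tor M) (a' : Fin d × Fin d) (y : Tor M) (j : Fin d → Fin n) (a : Fin d × Fin d) :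
    edgeAvgC n M (y', a') (bpt n M y j, a)
      = if a = a' ∧ y = y' ∧ j ∈ edgeOffsets n a'.1 a'.2 then (((n : ℂ) ^ (d - 2))⁻¹) else 0 := by
  simp only [edgeAvgC, Matrix.of_apply]
  by_cases ha : a = a'
  · rw [if_pos ha]
    have hiff : ∀ j' : Fin d → Fin n, bpt n M y j = bpt n M y' j' ↔ y = y' ∧ j = j' := by
      intro j'
      constructor
      · intro h
        have h2 := bpt_injective n M (a₁ := (y, j)) (a₂ := (y', j')) h
        exact ⟨(Prod.mk.inj h2).1, (Prod.mk.inj h2).2⟩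
      · exact fun h => by rw [h.1, h.2]
    simp_rw [hiff]
    by_cases hy : y = y'
    · subst hy
      simp [Finset.sum_ite_eq, ha]
    · rw [if_neg (fun h => hy h.2.1)]
      exact Finset.sum_eq_zero fun j' _ => if_neg (fun h => hy h.1)
  · rw [if_neg ha, if_neg (fun h => ha h.1)]

/-- `|B^e_k(y;μν)| = n^{d−2}` for an orientation `μ ≠ ν` (the count behind `L^{−(d−2)}Σ` = average in (2.21)).
[cite: BalabanImbrieJaffe1985, (2.21) p.305] -/
theorem card_edgeOffsets {μ ν : Fin d} (hμν : μ ≠ ν) : (edgeOffsets n μ ν).card = n ^ (d - 2) := by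
  rw [edgeOffsets, Fintype.card_piFinset]
  have h1 : ∀ ρ, (edgeSlots n μ ν ρ).card = if ρ = μ ∨ ρ = ν then 1 else n := by
    intro ρ
    unfold edgeSlots
    split_ifs
    · rw [Finset.card_singleton]
    · rw [Finset.card_univ, Fintype.card_fin]
  simp_rw [h1]
  rw [Finset.prod_ite, Finset.prod_const_one, one_mul, Finset.prod_const]
  congr 1
  have h2 : (Finset.univ.filter fun ρ : Fin d => ¬(ρ = μ ∨ ρ = ν)) = (Finset.univ.erase μ).erase ν := by
    ext ρ
    simp only [Finset.mem_filter, Finset.mem_univ, true_and, Finset.mem_erase, not_or]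
    tauto
  rw [h2, Finset.card_erase_of_mem (Finset.mem_erase.mpr ⟨Ne.symm hμν, Finset.mem_univ ν⟩),
    Finset.card_erase_of_mem (Finset.mem_univ μ), Finset.card_univ, Fintype.card_fin]
  omega

omit hM in
/-- kernel: `η^{−d}·η^{d−2} = η^{−2}`, i.e. `n^d·(n^{d−2})^{−1} = n²` (`2 ≤ d`). [cite: BalabanImbrieJaffe1985, (2.24) p.305] -/
theorem natCast_pow_mul_inv (hd : 2 ≤ d) : (n : ℂ) ^ d * ((n : ℂ) ^ (d - 2))⁻¹ = (n : ℂ) ^ 2 := by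
  have hn : (n : ℂ) ≠ 0 := by exact_mod_cast NeZero.ne n
  have h : (n : ℂ) ^ d = (n : ℂ) ^ (d - 2) * (n : ℂ) ^ 2 := by rw [← pow_add, Nat.sub_add_cancel hd]
  rw [h, mul_comm, ← mul_assoc, inv_mul_cancel₀ (pow_ne_zero _ hn), one_mul]

/-! ## §2 `Q^{e*}_k`: the adjoint between `⟨·,·⟩_η` and `⟨·,·⟩_1`, and (2.22)_k -/

/-- **`Q^{e*}_k`** — the adjoint of the k-fold edge average with respect to the scalar products (2.20), `⟨f,g⟩_η = η^dΣ_p f̄_pg_p` on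
η-plaquette fields and `⟨f,g⟩_1 = Σ_{p′} f̄_{p′}g_{p′}` on unit plaquette fields: as a matrix, `η^{−d}·(Q^e_k)ᴴ`.
[cite: BalabanImbrieJaffe1985, (2.22) p.305] -/
def edgeAdjC : Matrix (Tor (fine n M) × (Fin d × Fin d)) (Tor M × (Fin d × Fin d)) ℂ :=
  ((n : ℂ) ^ d) • (edgeAvgC n M)ᴴ

/-- **Adjointness for the weighted scalar products (2.20)**: `⟨g, Q^e_kf⟩_1 = ⟨Q^{e*}_kg, f⟩_η`, i.e.
`Σ ḡ·(Q^e_kf) = η^d·Σ conj(Q^{e*}_kg)·f`. [cite: BalabanImbrieJaffe1985, (2.20) p.305] -/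
theorem inner_edgeAvgC (g : Tor M × (Fin d × Fin d) → ℂ) (f : Tor (fine n M) × (Fin d × Fin d) → ℂ) :
    star g ⬝ᵥ (edgeAvgC n M *ᵥ f) = (((n : ℂ) ^ d)⁻¹) * (star (edgeAdjC n M *ᵥ g) ⬝ᵥ f) := by
  have hn : ((n : ℂ) ^ d) ≠ 0 := pow_ne_zero _ (by exact_mod_cast NeZero.ne n)
  rw [edgeAdjC, Matrix.smul_mulVec, star_smul, Matrix.star_mulVec, Matrix.conjTranspose_conjTranspose,
    smul_dotProduct, ← Matrix.dotProduct_mulVec, smul_eq_mul, ← mul_assoc]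
  rw [Complex.star_def, ← Complex.ofReal_natCast, ← Complex.ofReal_pow, Complex.conj_ofReal, Complex.ofReal_pow,
    Complex.ofReal_natCast, inv_mul_cancel₀ hn, one_mul]

/-- **(2.22) composed k times** p. 305, *"(Q^{e*}f)(p) = L²f(p′) if p ∈ B^e(p′), 0 otherwise"*: for the k-fold operator,
`(Q^{e*}_kg)_{μν}(n·y + j) = η^{−2}·g_{μν}(y)` if `j ∈ B^e_k(μν)` and `0` otherwise (`η^{−2} = n² = L^{2k}`; `2 ≤ d`).
[cite: BalabanImbrieJaffe1985, (2.22) p.305] -/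
theorem edgeAdjC_mulVec (hd : 2 ≤ d) (g : Tor M × (Fin d × Fin d) → ℂ) (y : Tor M) (j : Fin d → Fin n) (μ ν : Fin d) :
    (edgeAdjC n M *ᵥ g) (bpt n M y j, (μ, ν))
      = if j ∈ edgeOffsets n μ ν then (n : ℂ) ^ 2 * g (y, (μ, ν)) else 0 := by
  rw [edgeAdjC, Matrix.smul_mulVec, Pi.smul_apply, smul_eq_mul, Matrix.mulVec, dotProduct,
    Fintype.sum_prod_type, Finset.sum_eq_single y]
  · rw [Finset.sum_eq_single (μ, ν)]
    · rw [Matrix.conjTranspose_apply, edgeAvgC_apply_bpt]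
      simp only [true_and]
      split_ifs with hj
      · rw [Complex.star_def, map_inv₀, map_pow, Complex.conj_natCast, ← mul_assoc, natCast_pow_mul_inv n hd]
      · rw [star_zero, zero_mul, mul_zero]
    · intro a _ ha
      rw [Matrix.conjTranspose_apply, edgeAvgC_apply_bpt, if_neg (fun h => ha h.1.symm), star_zero, zero_mul]
    · exact fun h => absurd (Finset.mem_univ _) h
  · intro y' _ hy'
    refine Finset.sum_eq_zero fun a _ => ?_
    rw [Matrix.conjTranspose_apply, edgeAvgC_apply_bpt, if_neg (fun h => hy' h.2.1.symm), star_zero, zero_mul]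
  · exact fun h => absurd (Finset.mem_univ _) h

/-! ## §3 (2.24): `Q^e_kQ^{e*}_k = η^{−2}I` -/

/-- **(2.24)** p. 305, *"Q^e_kQ^{e*}_k = L^{2k}I = η^{−2}I"* — PROVED for the configuration-space operator on every orientation `μ ≠ ν`:
`(Q^e_kQ^{e*}_kg)_{μν}(y) = n²·g_{μν}(y)` (`η^{d−2}·|B^e_k|·η^{−2} = η^{−2}`, `|B^e_k| = n^{d−2}`).
[cite: BalabanImbrieJaffe1985, (2.24) p.305] -/
theorem edgeAvgC_edgeAdjC_mulVec (hd : 2 ≤ d) {μ ν : Fin d} (hμν : μ ≠ ν) (g : Tor M × (Fin d × Fin d) → ℂ) (y : Tor M) :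
    (edgeAvgC n M *ᵥ (edgeAdjC n M *ᵥ g)) (y, (μ, ν)) = (n : ℂ) ^ 2 * g (y, (μ, ν)) := by
  have hn : ((n : ℂ) ^ (d - 2)) ≠ 0 := pow_ne_zero _ (by exact_mod_cast NeZero.ne n)
  rw [edgeAvgC_mulVec]
  have h1 : ∀ j ∈ edgeOffsets n μ ν, (edgeAdjC n M *ᵥ g) (bpt n M y j, (μ, ν)) = (n : ℂ) ^ 2 * g (y, (μ, ν)) := by
    intro j hj
    rw [edgeAdjC_mulVec n M hd, if_pos hj]
  rw [Finset.sum_congr rfl h1, Finset.sum_const, card_edgeOffsets n hμν, nsmul_eq_mul]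
  push_cast
  field_simp

/-- **(2.24) entrywise**: `(Q^e_kQ^{e*}_k)((y,μν),(y′,a′)) = n²·δ` for `μ ≠ ν`. [cite: BalabanImbrieJaffe1985, (2.24) p.305] -/
theorem edgeAvgC_mul_edgeAdjC_apply (hd : 2 ≤ d) {μ ν : Fin d} (hμν : μ ≠ ν) (y y' : Tor M) (a' : Fin d × Fin d) :
    (edgeAvgC n M * edgeAdjC n M) (y, (μ, ν)) (y', a')
      = if (y, (μ, ν)) = (y', a') then (n : ℂ) ^ 2 else 0 := by
  have h : (edgeAvgC n M * edgeAdjC n M) (y, (μ, ν)) (y', a')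
      = (edgeAvgC n M *ᵥ (edgeAdjC n M *ᵥ (Pi.single (y', a') (1 : ℂ)))) (y, (μ, ν)) := by
    rw [Matrix.mulVec_mulVec, Matrix.mulVec_single_one]
    rfl
  rw [h, edgeAvgC_edgeAdjC_mulVec n M hd hμν, Pi.single_apply]
  split_ifs <;> simp

/-- `Q^e_kQ^{e*}_k` is a translation-invariant unit-lattice operator (cross ∘ cross^*). [cite: BalabanImbrieJaffe1985, (2.24) p.305] -/
theorem isTranslInv_edgeAvgC_mul_edgeAdjC :
    IsTranslInvR M (Fin d × Fin d) (Fin d × Fin d) (edgeAvgC n M * edgeAdjC n M) := by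
  rw [edgeAdjC, Matrix.mul_smul]
  exact (IsCrossTI.mul_conjTranspose (isCrossTI_edgeAvgC n M) (isCrossTI_edgeAvgC n M)).smul _

/-! ## §4 (2.24) in momentum space: `Σ_l |w_{μν}(p′+l)|² = η^{−2}` -/

/-- kernel: the symbol of `Q^e_kQ^{e*}_k` at `p′`, diagonal entry `μν` (`μ ≠ ν`), computed in configuration space: `n²`.
[cite: BalabanImbrieJaffe1985, (2.24) p.305] -/
private theorem symbR_prod_config (hd : 2 ≤ d) {μ ν : Fin d} (hμν : μ ≠ ν) (q : Tor M) :
    symbR M (Fin d × Fin d) (Fin d × Fin d) (edgeAvgC n M * edgeAdjC n M) q (μ, ν) (μ, ν) = (n : ℂ) ^ 2 := by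
  rw [symbR_apply, Finset.sum_eq_single (0 : Tor M)]
  · rw [edgeAvgC_mul_edgeAdjC_apply n M hd hμν, if_pos rfl, chi_zero_right, map_one, mul_one]
  · intro z _ hz
    rw [edgeAvgC_mul_edgeAdjC_apply n M hd hμν, if_neg (fun h => hz (Prod.mk.inj h).1), zero_mul]
  · exact fun h => absurd (Finset.mem_univ _) h

/-- kernel: the same symbol entry computed by the symbol calculus: `Σ_l w_{μν}(p′+l)·w̄_{μν}(p′+l)` (`n^d·c² = 1`).
[cite: BalabanImbrieJaffe1985, (7.1.11) p.322] -/
private theorem symbR_prod_momentum (μ ν : Fin d) (q : Tor M) :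
    symbR M (Fin d × Fin d) (Fin d × Fin d) (edgeAvgC n M * edgeAdjC n M) q (μ, ν) (μ, ν)
      = ∑ k : Fin d → Fin n, edgeW n k (sOf M q) μ ν * conj (edgeW n k (sOf M q) μ ν) := by
  have hn : ((n : ℂ) ^ d) ≠ 0 := pow_ne_zero _ (by exact_mod_cast NeZero.ne n)
  rw [edgeAdjC, Matrix.mul_smul, symbR_smul,
    symb_mul_conjTranspose n M (Fin d × Fin d) (Fin d × Fin d) (Fin d × Fin d) (isCrossTI_edgeAvgC n M)
      (isCrossTI_edgeAvgC n M) q,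
    smul_smul, cQ_sq, mul_inv_cancel₀ hn, one_smul, Matrix.sum_apply]
  refine Finset.sum_congr rfl fun k _ => ?_
  rw [Matrix.mul_apply, Finset.sum_eq_single (μ, ν)]
  · rw [Matrix.conjTranspose_apply, symbX_edgeAvgC_pOf, if_pos rfl, Complex.star_def]
  · rintro ⟨μ', ν'⟩ _ hb
    rw [symbX_edgeAvgC_pOf, if_neg hb, zero_mul]
  · exact fun h => absurd (Finset.mem_univ _) h

/-- **(2.24) IN MOMENTUM SPACE**: the (7.1.11) weight satisfies `Σ_l |w_{μν}(p′+l)|² = n² = η^{−2}` at every unit momentum `p′`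
(orientation `μ ≠ ν`, `2 ≤ d`) — the symbol of `Q^e_kQ^{e*}_k = η^{−2}I`; with `|w_{μν}| = Π_{ρ∉{μ,ν}}|v_ρ|` (`norm_edgeW`) this is the
product of the one-dimensional averaging identities `Σ_{l_ρ}|v_ρ(p′+l)|² = 1`. [cite: BalabanImbrieJaffe1985, (2.24) p.305] -/
theorem sum_normSq_edgeW (hd : 2 ≤ d) {μ ν : Fin d} (hμν : μ ≠ ν) (q : Tor M) :
    ∑ k : Fin d → Fin n, ‖edgeW n k (sOf M q) μ ν‖ ^ 2 = (n : ℝ) ^ 2 := by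
  have h := (symbR_prod_momentum n M μ ν q).symm.trans (symbR_prod_config n M hd hμν q)
  simp_rw [Complex.mul_conj'] at h
  exact_mod_cast h

end

end Literature.MathematicalPhysics.QuantumFieldTheory.BalabanImbrieJaffe1984to88.BIJ85Eq7111EdgeAdjoint
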